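import Summits.QuantumAdvantage.QuantumAdvantage.Theorems.LinnikCubicClassGroupsDegreeOnePrimesEscapeClassPNTDHNumerics
import Literature.NumberTheory.LFunctions.RayClassFamilyZeroSum
import HarnessLib

/-!
# Linnik's theorem for cosets of a congruence class group, III: preliminaries — the family zero sum with a generic
# size parameter, and the junk-term numerics

Topic `Summits/QuantumAdvantage/QuantumAdvantage/Theorems`, cell B2b-1 (linnik-cubic), PART A (gen 22); helper toward
the crux `DegreeOnePrimesEscape` (stmt-QuantumAdvantage-11543) of route `LinnikCubicClassGroups`.  HONEST FRAMING: the
value of this file is a THEOREM (kernel-checked lemmas) — NOT summit progress.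

* `rayFam_zeroSum_le_zfr_of_le` — `rayFam_zeroSum_le_zfr` (Thorner–Zaman §4.3 for the family `F_ψ` of a congruence
  class group `mod 𝔪`) with the size parameter `Q_𝔪 = |d_K| n^n N𝔪` replaced by ANY `Q ≥ Q_𝔪` with `|G| ≤ Q⁴`
  (the abstract `EntireEF.family_zeroSum_le_zfr` instantiated at `Q`): this lets the final assembly take `Q` a fixed
  power of `Q_𝔪`, so that the effective repulsion of the exceptional zero and the size of `G` enter with exponent `2`
  resp. `4` relative to `Q`, as the real-variable numerics of `…ClassPNTDHNumerics` require;
* `junk_small'` — `…ClassPNTDHNumerics.junk_small` with the constant `1152` of the trivial-zero term replaced by a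
  parameter `k₀ ≥ 0`;
* `imprimitive_term_le` — `2(L + 2)·(L/8) ≤ 24 e^{L/4}` for `L ≥ 64` (absorbs the imprimitive correction
  `2(L+2) log N𝔪`, `log N𝔪 ≤ L/8`, into the trivial-zero term); `absNorm_le_rayCondQ` — `N𝔪 ≤ Q_𝔪`.

References: J. Thorner, A. Zaman, Algebra Number Theory 13 (2019), §4.3, §5 [ThornerZaman2019]; A. Weiss, J. reine
angew. Math. 338 (1983), §6 [Weiss1983].
-/

noncomputable section

open Complex Real Set Filter Topology NumberField IsDedekindDomain
open scoped NumberField nonZeroDivisors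

namespace Summit.QuantumAdvantage.QuantumAdvantage.Theorems.DegreeOnePrimesEscape

open Literature.NumberTheory.LFunctions Literature.NumberTheory.LFunctions.NumberField
  Literature.NumberTheory.LFunctions.EntireEF Literature.NumberTheory.LFunctions.TZWeight
  Literature.NumberTheory.LFunctions.AbelianDensity
open scoped Classical

/-! ### The family zero sum with a generic size parameter -/

set_option maxHeartbeats 800000 in
/-- **Thorner–Zaman §4.3 for the family of a congruence class group `mod 𝔪`, zero-free region as a parameter,
generic size parameter `Q ≥ Q_𝔪` with `|G| ≤ Q⁴`.** [cite: ThornerZaman2019, §4.3] [cite: Weiss1983, §6] -/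
theorem rayFam_zeroSum_le_zfr_of_le (n : ℕ) (hn : 1 < n) {b D a : ℝ} (hb : 0 < b) (hD : 0 < D) (ha : 1 ≤ a) :
    ∃ ν a₀ A₀ : ℝ, 0 < ν ∧ ν ≤ 1 / 64 ∧ 1 ≤ a₀ ∧ 0 < A₀ ∧
    ∀ (c : ℝ) (K : Type) [Field K] [NumberField K], Module.finrank ℚ K = n →
    ∀ (G : Type) [CommGroup G] [Finite G] (𝔪 : Ideal (𝓞 K)) (f : HeightOneSpectrum (𝓞 K) → G)
      (h𝔪 : 𝔪 ≠ ⊥) (hray : ArtinKillsRay 𝔪 f)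
      (hsep : ∀ χ : AddChar (Additive G) ℂ, χ ≠ 0 →
        ∃ v : HeightOneSpectrum (𝓞 K), ¬ 𝔪 ≤ v.asIdeal ∧ χ (Additive.ofMul (f v)) ≠ 1) (Q : ℝ),
      rayCondQ K 𝔪 ≤ Q → (Nat.card G : ℝ) ≤ Q ^ (4 : ℕ) →
      (∀ (T : ℝ), 1 ≤ T → ∀ u : AddChar (Additive G) ℂ → Finset ℂ,
        (∀ ψ, ∀ ρ ∈ u ψ, rayFamF h𝔪 hray hsep ψ ρ = 0 ∧ 1 / 4 ≤ ρ.re ∧ ρ.re < 1 ∧ |ρ.im| ≤ T) →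
        ∀ α : ℝ, α ≤ 1 →
          ∑ ψ, ∑ ρ ∈ u ψ with α ≤ ρ.re, (analyticOrderNatAt (rayFamF h𝔪 hray hsep ψ) ρ : ℝ) ≤
            D * Real.exp (b * (a * Real.log Q + Real.log (T + 4))) ^ (1 - α)) →
      ∀ x : ℝ, Q ^ a₀ ≤ x → ∀ c_Z : ℝ, 0 < c_Z →
      (∀ (ψ : AddChar (Additive G) ℂ) (ρ : ℂ), rayFamF h𝔪 hray hsep ψ ρ = 0 → 1 / 4 ≤ ρ.re →
        ρ.re < 1 → |ρ.im| ≤ x → ¬ rayExcRegion c K 𝔪 ρ →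
          ρ.re ≤ 1 - c_Z / (a * Real.log Q + Real.log (|ρ.im| + 4))) →
      ∀ ε : ℝ, x ^ (-ν) ≤ ε → ε ≤ 1 →
      ∀ u : AddChar (Additive G) ℂ → Finset ℂ,
        (∀ ψ, ∀ ρ ∈ u ψ, rayFamF h𝔪 hray hsep ψ ρ = 0 ∧ 0 < ρ.re ∧ ρ.re < 1) →
        ∑ ψ, ∑ ρ ∈ u ψ with ¬ rayExcRegion c K 𝔪 ρ,
            (analyticOrderNatAt (rayFamF h𝔪 hray hsep ψ) ρ : ℝ) * ‖fordLaplace (tzTest (Real.log x) ε) (-ρ)‖ ≤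
          A₀ * x * (Real.exp (-(c_Z * Real.log x / (4 * a * Real.log Q))) +
              Real.exp (-Real.sqrt (c_Z * Real.log x / 4))) + A₀ * x ^ (1 - ν) := by
  obtain ⟨ν, a₀, A₀, hν, hν64, ha₀, hA₀, h⟩ :=
    family_zeroSum_le_zfr (512 * ((n : ℝ) + 1)) (by positivity) hb hD ha
  refine ⟨ν, a₀, A₀, hν, hν64, ha₀, hA₀,
    fun c K _ _ hKn G _ _ 𝔪 f h𝔪 hray hsep Q hQK hG hdens x hx c_Z hcZ hzfr ε hεν hε1 u hu ↦ ?_⟩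
  have hK : 1 < Module.finrank ℚ K := by rw [hKn]; exact hn
  have hQ12 : (12 : ℝ) ≤ Q := (twelve_le_rayCondQ hK h𝔪).trans hQK
  have hcard : (Fintype.card (AddChar (Additive G) ℂ) : ℝ) ≤ Q ^ 4 := by
    rw [card_addChar_eq_natCard]; exact_mod_cast hG
  have hAnn : 0 ≤ Real.log (((discr K).natAbs : ℝ) * ((Ideal.absNorm 𝔪 : ℕ) : ℝ)) + 3 * Module.finrank ℚ K := by
    have := Real.log_nonneg (one_le_discr_mul_absNorm K h𝔪); positivity
  have hAQ : Real.log (((discr K).natAbs : ℝ) * ((Ideal.absNorm 𝔪 : ℕ) : ℝ)) + 3 * Module.finrank ℚ K ≤ 4 * Q :=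
    (windowConst_le_rayCondQ h𝔪).trans (by linarith)
  have hwin : ∀ (ψ : AddChar (Additive G) ℂ) (τ : ℝ) (P : Finset ℂ),
      (∀ ρ ∈ P, rayFamF h𝔪 hray hsep ψ ρ = 0 ∧ 0 < ρ.re ∧ ρ.re < 1 ∧ |ρ.im - τ| ≤ 1 / 2) →
      ∑ ρ ∈ P, (analyticOrderNatAt (rayFamF h𝔪 hray hsep ψ) ρ : ℝ) ≤ (512 * ((n : ℝ) + 1)) *
        ((Real.log (((discr K).natAbs : ℝ) * ((Ideal.absNorm 𝔪 : ℕ) : ℝ)) + 3 * Module.finrank ℚ K) +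
          Real.log (|τ| + 4)) := by
    intro ψ τ P hP
    have hw := rayFam_window h𝔪 hray hsep ψ τ P hP
    rw [hKn] at hw ⊢
    exact hw
  exact h (AddChar (Additive G) ℂ) (rayFamF h𝔪 hray hsep) (differentiable_rayFamF h𝔪 hray hsep) 2
    (rayFamF_two_ne_zero h𝔪 hray hsep) Q hQ12 hcard _ hAnn hAQ hwin hdens (rayExcRegion c K 𝔪) x hx c_Z hcZ
    hzfr ε hεν hε1 u hu

/-! ### Numerics of the junk terms -/

/-- **The trivial-zero, left-line and tail terms are `≤ (η/4) x · c₁Q^{−2}`** (`…DHNumerics.junk_small` with the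
constant `1152` replaced by a parameter `k₀ ≥ 0`): for `Q ≥ 12`, `x ≥ Q^{a₁}` (`a₁ ≥ 32`,
`a₁ν ≥ 2 + max(0, log(4(A₀ + k₀ + C_J)/(ηc₁)))`), `0 < ν ≤ 1/64`, `h ≤ Q⁴`:
`A₀ x^{1−ν} + h (k₀ e^{(log x)/4} + C_J) ≤ (η/4)·x·(c₁ Q^{−2})`. [folklore] -/
theorem junk_small' {A₀ CJ k₀ h Q x ν η c₁ a₁ : ℝ} (hA₀ : 0 < A₀) (hCJ : 0 ≤ CJ) (hk₀ : 0 ≤ k₀) (hQ : 12 ≤ Q)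
    (hh : h ≤ Q ^ 4) (hν : 0 < ν) (hν1 : ν ≤ 1 / 64) (hη : 0 < η) (hc₁ : 0 < c₁)
    (hx : Q ^ a₁ ≤ x) (ha₁ : 32 ≤ a₁)
    (ha₁J : (2 + max 0 (Real.log (4 * (A₀ + k₀ + CJ) / (η * c₁)))) / ν ≤ a₁) :
    A₀ * x ^ (1 - ν) + h * (k₀ * Real.exp (Real.log x / 4) + CJ) ≤
      η / 4 * x * (c₁ * Q ^ (-(2 : ℝ))) := by
  have hQ0 : 0 < Q := by linarith
  have hQ1 : (1 : ℝ) ≤ Q := by linarith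
  have hxQ : Q ≤ x := by
    have := Real.rpow_le_rpow_of_exponent_le hQ1 (by linarith : (1 : ℝ) ≤ a₁)
    rw [Real.rpow_one] at this; exact this.trans hx
  have hx1 : (1 : ℝ) ≤ x := by linarith
  have hx0 : 0 < x := by linarith
  -- `h ≤ Q⁴ ≤ x^{1/8}`
  have hQ4 : Q ^ 4 ≤ x ^ ((1 : ℝ) / 8) := by
    have h1 : (Q ^ (4 : ℕ) : ℝ) = (Q ^ a₁) ^ ((4 : ℝ) / a₁) := by
      rw [← Real.rpow_mul hQ0.le, mul_div_cancel₀ _ (by linarith : a₁ ≠ 0)]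
      norm_cast
    rw [h1]
    calc (Q ^ a₁) ^ ((4 : ℝ) / a₁) ≤ x ^ ((4 : ℝ) / a₁) :=
          Real.rpow_le_rpow (Real.rpow_nonneg hQ0.le _) hx (by positivity)
      _ ≤ x ^ ((1 : ℝ) / 8) := by
          refine Real.rpow_le_rpow_of_exponent_le hx1 ?_
          rw [div_le_iff₀ (by linarith)]; linarith
  have hh' : h ≤ x ^ ((1 : ℝ) / 8) := hh.trans hQ4
  have hexp : Real.exp (Real.log x / 4) = x ^ ((1 : ℝ) / 4) := by
    rw [Real.rpow_def_of_pos hx0]; ring_nf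
  have hpow1 : x ^ ((1 : ℝ) / 8) * x ^ ((1 : ℝ) / 4) ≤ x ^ (1 - ν) := by
    rw [← Real.rpow_add hx0]
    exact Real.rpow_le_rpow_of_exponent_le hx1 (by linarith)
  have hpow2 : x ^ ((1 : ℝ) / 8) ≤ x ^ (1 - ν) := Real.rpow_le_rpow_of_exponent_le hx1 (by linarith)
  have hJ1 : h * (k₀ * Real.exp (Real.log x / 4)) ≤ k₀ * x ^ (1 - ν) := by
    rw [hexp]
    calc h * (k₀ * x ^ ((1 : ℝ) / 4)) ≤ x ^ ((1 : ℝ) / 8) * (k₀ * x ^ ((1 : ℝ) / 4)) :=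
          mul_le_mul_of_nonneg_right hh' (by positivity)
      _ = k₀ * (x ^ ((1 : ℝ) / 8) * x ^ ((1 : ℝ) / 4)) := by ring
      _ ≤ k₀ * x ^ (1 - ν) := mul_le_mul_of_nonneg_left hpow1 hk₀
  have hJ2 : h * CJ ≤ CJ * x ^ (1 - ν) := by
    calc h * CJ ≤ x ^ ((1 : ℝ) / 8) * CJ := mul_le_mul_of_nonneg_right hh' hCJ
      _ = CJ * x ^ ((1 : ℝ) / 8) := mul_comm _ _
      _ ≤ CJ * x ^ (1 - ν) := mul_le_mul_of_nonneg_left hpow2 hCJ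
  have hsum : A₀ * x ^ (1 - ν) + h * (k₀ * Real.exp (Real.log x / 4) + CJ) ≤
      (A₀ + k₀ + CJ) * x ^ (1 - ν) := by
    rw [mul_add h]; nlinarith [hJ1, hJ2]
  set AJ : ℝ := A₀ + k₀ + CJ with hAJ
  have hAJ0 : 0 < AJ := by rw [hAJ]; positivity
  have hth := mul_rpow_neg_le_one_of_threshold (k := 2) (M := 4 * AJ / (η * c₁)) hQ hx hν
    (by positivity) (by have := (div_le_iff₀ hν).1 ha₁J; linarith)
  have hxν : x ^ (1 - ν) = x * x ^ (-ν) := by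
    rw [sub_eq_add_neg, Real.rpow_add hx0, Real.rpow_one]
  have hQ2 : Q ^ (2 : ℝ) * Q ^ (-(2 : ℝ)) = 1 := by
    rw [← Real.rpow_add hQ0]; norm_num
  have hQm2 : 0 < Q ^ (-(2 : ℝ)) := Real.rpow_pos_of_pos hQ0 _
  refine hsum.trans ?_
  rw [hxν]
  have := mul_le_mul_of_nonneg_left hth (by positivity : (0 : ℝ) ≤ η / 4 * x * (c₁ * Q ^ (-(2 : ℝ))))
  rw [mul_one] at this
  refine le_trans (le_of_eq ?_) this
  have hη0 : η ≠ 0 := hη.ne'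
  have hc0 : c₁ ≠ 0 := hc₁.ne'
  calc AJ * (x * x ^ (-ν)) = AJ * (x * x ^ (-ν)) * (Q ^ (2 : ℝ) * Q ^ (-(2 : ℝ))) := by rw [hQ2, mul_one]
    _ = η / 4 * x * (c₁ * Q ^ (-(2 : ℝ))) * (4 * AJ / (η * c₁) * Q ^ (2 : ℝ) * x ^ (-ν)) := by
        field_simp

/-- **The imprimitive correction is absorbed by the trivial-zero term**: `2(L + 2)·(L/8) ≤ 24 e^{L/4}` for
`L ≥ 64` (`e^{L/4} ≥ (L/4)³/6`). [folklore] -/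
theorem imprimitive_term_le {L l : ℝ} (hL : 64 ≤ L) (hl : l ≤ L / 8) :
    2 * (L + 2) * l ≤ 24 * Real.exp (L / 4) := by
  have hL0 : 0 ≤ L / 4 := by linarith
  have h3 : (L / 4) ^ 3 / (Nat.factorial 3) ≤ Real.exp (L / 4) := Real.pow_div_factorial_le_exp (L / 4) hL0 3
  have hfac : ((Nat.factorial 3 : ℕ) : ℝ) = 6 := by norm_num [Nat.factorial]
  rw [hfac] at h3
  have h4 : 2 * (L + 2) * l ≤ 2 * (L + 2) * (L / 8) := mul_le_mul_of_nonneg_left hl (by positivity)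
  have hLL : 64 * L ≤ L * L := by nlinarith
  have hL3 : 64 * (L * L) ≤ L ^ 3 := by
    have := mul_le_mul_of_nonneg_right hL (mul_self_nonneg L)
    nlinarith [this]
  have h5 : 2 * (L + 2) * (L / 8) ≤ L ^ 3 / 16 := by nlinarith [hLL, hL3]
  have h6 : L ^ 3 / 16 ≤ 24 * ((L / 4) ^ 3 / 6) := by nlinarith
  linarith

/-- `N𝔪 ≤ Q_𝔪` (`Q_𝔪 = condQn K · N𝔪`, `condQn K ≥ 1`). [folklore] -/
theorem absNorm_le_rayCondQ {K : Type} [Field K] [NumberField K] (𝔪 : Ideal (𝓞 K)) :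
    ((Ideal.absNorm 𝔪 : ℕ) : ℝ) ≤ rayCondQ K 𝔪 := by
  unfold rayCondQ
  have h1 : (1 : ℝ) ≤ ThornerZaman.condQn K := by
    unfold ThornerZaman.condQn
    have hd : (1 : ℝ) ≤ |(discr K : ℝ)| := by
      have := Int.one_le_abs (discr_ne_zero K)
      rw [← Int.cast_abs]; exact_mod_cast this
    have hn : (1 : ℝ) ≤ (Module.finrank ℚ K : ℝ) ^ Module.finrank ℚ K :=
      one_le_pow₀ (by exact_mod_cast Module.finrank_pos (R := ℚ) (M := K))
    nlinarith
  have h0 : (0 : ℝ) ≤ ((Ideal.absNorm 𝔪 : ℕ) : ℝ) := Nat.cast_nonneg _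
  nlinarith

end Summit.QuantumAdvantage.QuantumAdvantage.Theorems.DegreeOnePrimesEscape

end
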